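import Literature.MathematicalPhysics.QuantumManyBody.GroundState
import Summits.AtomisticToContinuum.BoseEinsteinCondensation.Theorems.BECCutLineWeakDisorderGroundStateRigidityUniqueOfRigid
import HarnessLib

/-!
# Crux `GroundStateRigidity` (stmt-AtomisticToContinuum-9072), line `Sketch`:
# the registered stub `stub_lincombGroundState`

Supports (does not close) stmt-AtomisticToContinuum-9072; stub `stub_lincombGroundState` of line
`Sketch` (lead c2). **Normalised linear combinations of closed-form ground states are ground
states** (Reed–Simon IV Thm XIII.46, variational form; EVERY pair potential `v`, no measurability).
Trial states `Sₙ → Ψ`, `Tₙ → Φ` with energies `≤ E₀ + 1/(n+1)` (`exists_trialState_near`) give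
`Gₙ = aSₙ + bTₙ`, `Dₙ = aSₙ - bTₙ`. The raw form `Q(f) = ∫⁻ (|∇f|² + V|f|²)` on `C¹` functions
scales, `Q(cf) = |c|²Q(f)`, and obeys the PARALLELOGRAM LAW (pointwise in the integrands; the
lower integral `B ↦ ∫⁻ W B` is additive on finite measurable `B` for ANY weight `W`,
`lintegral_mul_add`), and `Q(G) ≥ E₀ ∫|G|²` for `C¹` Dirichlet symmetric `G` (normalise). Hence
`Q(Gₙ) + E₀ ∫|Dₙ|² ≤ A (E₀ + 1/(n+1))` with `A = 2|a|² + 2|b|² = ∫|Gₙ|² + ∫|Dₙ|²` and `∫|Gₙ|² → 1`,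
so `Gₙ/‖Gₙ‖₂ → aΨ + bΦ` have energies `≤ (1 + o(1)) (A E₀ + o(1) - E₀ ∫|Dₙ|²) → A E₀ - E₀(A - 1)`,
which is `≤ E₀`: a ground state by `IsGroundState.of_tendstoL2`.
-/

noncomputable section

open MeasureTheory Filter
open scoped ENNReal NNReal Topology

namespace Summit.AtomisticToContinuum.BoseEinsteinCondensation.Theorems.GroundStateRigidity

open Literature.MathematicalPhysics.QuantumManyBody.BoseGas

namespace LincombGS

variable {N : ℕ}

/-- **Additivity of a weighted lower integral in the measurable factor**, for ANY weight
`W : α → [0, ∞]` and finite measurable `B₁, B₂`: `∫⁻ W (B₁ + B₂) = ∫⁻ W B₁ + ∫⁻ W B₂` (`≥`: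
superadditivity; `≤`: a measurable minorant `φ ≤ W (B₁ + B₂)` of full integral is `g (B₁ + B₂)`
with the MEASURABLE `g = φ / (B₁ + B₂) ≤ W`). [folklore] -/
theorem lintegral_mul_add {α : Type*} [MeasurableSpace α] (μ : Measure α) (W : α → ℝ≥0∞)
    {B₁ B₂ : α → ℝ≥0∞} (h₁ : Measurable B₁) (h₂ : Measurable B₂) (h₁t : ∀ x, B₁ x ≠ ⊤)
    (h₂t : ∀ x, B₂ x ≠ ⊤) :
    ∫⁻ x, W x * (B₁ x + B₂ x) ∂μ = (∫⁻ x, W x * B₁ x ∂μ) + ∫⁻ x, W x * B₂ x ∂μ := by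
  refine le_antisymm ?_ ?_
  · obtain ⟨φ, hφm, hφle, hφeq⟩ :=
      exists_measurable_le_lintegral_eq μ fun x => W x * (B₁ x + B₂ x)
    rw [hφeq]
    have hφle' : ∀ x, φ x ≤ W x * (B₁ x + B₂ x) := fun x => hφle x
    have hφ0 : ∀ x, B₁ x + B₂ x = 0 → φ x = 0 := fun x hx => by simpa [hx] using hφle' x
    set g : α → ℝ≥0∞ := fun x => φ x / (B₁ x + B₂ x) with hg
    have hgm : Measurable g := hφm.div (h₁.add h₂)
    have hgW : ∀ x, g x ≤ W x := fun x => by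
      by_cases hx : B₁ x + B₂ x = 0
      · simp only [hg, hφ0 x hx, ENNReal.zero_div]
        exact zero_le
      · exact ENNReal.div_le_of_le_mul (hφle' x)
    have hφg : ∀ x, φ x = g x * B₁ x + g x * B₂ x := fun x => by
      rw [← mul_add]
      exact (ENNReal.div_mul_cancel' (hφ0 x)
        (fun h => absurd h (ENNReal.add_ne_top.2 ⟨h₁t x, h₂t x⟩))).symm
    calc ∫⁻ x, φ x ∂μ = ∫⁻ x, g x * B₁ x + g x * B₂ x ∂μ := lintegral_congr hφg
      _ = (∫⁻ x, g x * B₁ x ∂μ) + ∫⁻ x, g x * B₂ x ∂μ := lintegral_add_left (hgm.fun_mul h₁) _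
      _ ≤ (∫⁻ x, W x * B₁ x ∂μ) + ∫⁻ x, W x * B₂ x ∂μ :=
          add_le_add (lintegral_mono fun x => mul_le_mul_left (hgW x) _)
            (lintegral_mono fun x => mul_le_mul_left (hgW x) _)
  · calc (∫⁻ x, W x * B₁ x ∂μ) + ∫⁻ x, W x * B₂ x ∂μ
        ≤ ∫⁻ x, W x * B₁ x + W x * B₂ x ∂μ := le_lintegral_add _ _
      _ = ∫⁻ x, W x * (B₁ x + B₂ x) ∂μ := lintegral_congr fun x => (mul_add _ _ _).symm

/-- The parallelogram law in `ℂ`, squared norms in `ℝ≥0∞`. [folklore] -/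
theorem nnnorm_sq_add_sub (x y : ℂ) :
    (‖x + y‖₊ : ℝ≥0∞) ^ 2 + (‖x - y‖₊ : ℝ≥0∞) ^ 2 =
      2 * (‖x‖₊ : ℝ≥0∞) ^ 2 + 2 * (‖y‖₊ : ℝ≥0∞) ^ 2 := by
  have h : ‖x + y‖₊ ^ 2 + ‖x - y‖₊ ^ 2 = 2 * ‖x‖₊ ^ 2 + 2 * ‖y‖₊ ^ 2 := by
    simp only [sq]
    rw [parallelogram_law_with_nnnorm_mul ℂ x y, mul_add]
  exact_mod_cast h

/-- The parallelogram law for the kinetic energy density (pointwise). [folklore] -/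
theorem kinetic_add_sub {f g : Config N → ℂ} (hf : Differentiable ℝ f) (hg : Differentiable ℝ g)
    (X : Config N) :
    kineticDensity (fun Y => f Y + g Y) X + kineticDensity (fun Y => f Y - g Y) X =
      2 * kineticDensity f X + 2 * kineticDensity g X := by
  simp only [kineticDensity, fderiv_fun_add (hf X) (hg X), fderiv_fun_sub (hf X) (hg X),
    _root_.add_apply, _root_.sub_apply, Finset.mul_sum, ← Finset.sum_add_distrib]
  exact Finset.sum_congr rfl fun i _ => Finset.sum_congr rfl fun k _ => nnnorm_sq_add_sub _ _

/-- Scaling of the kinetic energy density by a complex constant. [folklore] -/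
theorem kinetic_const_mul (c : ℂ) {f : Config N → ℂ} (hf : Differentiable ℝ f) (X : Config N) :
    kineticDensity (fun Y => c * f Y) X = (‖c‖₊ : ℝ≥0∞) ^ 2 * kineticDensity f X := by
  simp only [kineticDensity, fderiv_const_mul (hf X) c, _root_.smul_apply, smul_eq_mul,
    nnnorm_mul, ENNReal.coe_mul, mul_pow, Finset.mul_sum]

/-- Scaling of the raw quadratic form: `Q(c f) = |c|² Q(f)`. [folklore] -/
theorem rawEnergy_const_mul (v : ℝ → ℝ≥0∞) (c : ℂ) {f : Config N → ℂ}
    (hf : Differentiable ℝ f) :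
    ∫⁻ X, kineticDensity (fun Y => c * f Y) X + interaction v X * (‖c * f X‖₊ : ℝ≥0∞) ^ 2 =
      (‖c‖₊ : ℝ≥0∞) ^ 2 *
        ∫⁻ X, kineticDensity f X + interaction v X * (‖f X‖₊ : ℝ≥0∞) ^ 2 := by
  rw [← lintegral_const_mul' _ _ (by finiteness)]
  refine lintegral_congr fun X => ?_
  rw [kinetic_const_mul c hf X, nnnorm_mul, ENNReal.coe_mul, mul_pow]
  ring

/-- **The parallelogram law for the raw quadratic form** `Q(f) = ∫⁻ (|∇f|² + V|f|²)` on `C¹`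
functions, for an ARBITRARY pair potential: `Q(f+g) + Q(f-g) = 2Q(f) + 2Q(g)`. [folklore] -/
theorem rawEnergy_add_sub (v : ℝ → ℝ≥0∞) {f g : Config N → ℂ} (hf : ContDiff ℝ 1 f)
    (hg : ContDiff ℝ 1 g) :
    (∫⁻ X, kineticDensity (fun Y => f Y + g Y) X +
        interaction v X * (‖f X + g X‖₊ : ℝ≥0∞) ^ 2) +
      ∫⁻ X, kineticDensity (fun Y => f Y - g Y) X +
        interaction v X * (‖f X - g X‖₊ : ℝ≥0∞) ^ 2 =
      2 * (∫⁻ X, kineticDensity f X + interaction v X * (‖f X‖₊ : ℝ≥0∞) ^ 2) +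
        2 * ∫⁻ X, kineticDensity g X + interaction v X * (‖g X‖₊ : ℝ≥0∞) ^ 2 := by
  have h2 : ∀ z : ℂ, (‖z‖₊ : ℝ≥0∞) ^ 2 ≠ ⊤ := fun z => by finiteness
  rw [lintegral_add_left (measurable_kineticDensity (hf.add hg)),
    lintegral_add_left (measurable_kineticDensity (hf.sub hg)),
    lintegral_add_left (measurable_kineticDensity hf),
    lintegral_add_left (measurable_kineticDensity hg)]
  -- kinetic part
  have hK : (∫⁻ X, kineticDensity (fun Y => f Y + g Y) X) +
      ∫⁻ X, kineticDensity (fun Y => f Y - g Y) X =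
        2 * (∫⁻ X, kineticDensity f X) + 2 * ∫⁻ X, kineticDensity g X := by
    rw [← lintegral_add_left (measurable_kineticDensity (hf.add hg)),
      ← lintegral_const_mul' _ _ ENNReal.ofNat_ne_top,
      ← lintegral_const_mul' _ _ ENNReal.ofNat_ne_top,
      ← lintegral_add_left ((measurable_kineticDensity hf).const_mul _)]
    exact lintegral_congr fun X =>
      kinetic_add_sub (hf.differentiable one_ne_zero) (hg.differentiable one_ne_zero) X
  -- potential part (no measurability of `v`)
  have hV : (∫⁻ X, interaction v X * (‖f X + g X‖₊ : ℝ≥0∞) ^ 2) +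
      ∫⁻ X, interaction v X * (‖f X - g X‖₊ : ℝ≥0∞) ^ 2 =
        2 * (∫⁻ X, interaction v X * (‖f X‖₊ : ℝ≥0∞) ^ 2) +
          2 * ∫⁻ X, interaction v X * (‖g X‖₊ : ℝ≥0∞) ^ 2 := by
    rw [← lintegral_mul_add volume (interaction v) (measurable_normSq (hf.add hg).continuous)
        (measurable_normSq (hf.sub hg).continuous) (fun _ => h2 _) (fun _ => h2 _),
      ← lintegral_const_mul' _ _ ENNReal.ofNat_ne_top,
      ← lintegral_const_mul' _ _ ENNReal.ofNat_ne_top]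
    have e : ∀ (h : Config N → ℂ) (X : Config N), 2 * (interaction v X * (‖h X‖₊ : ℝ≥0∞) ^ 2) =
        interaction v X * (2 * (‖h X‖₊ : ℝ≥0∞) ^ 2) := fun h X => by ring
    simp_rw [e]
    rw [← lintegral_mul_add volume (interaction v) ((measurable_normSq hf.continuous).const_mul _)
        ((measurable_normSq hg.continuous).const_mul _)
        (fun _ => ENNReal.mul_ne_top ENNReal.ofNat_ne_top (h2 _))
        (fun _ => ENNReal.mul_ne_top ENNReal.ofNat_ne_top (h2 _))]
    exact lintegral_congr fun X => by rw [nnnorm_sq_add_sub]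
  rw [add_add_add_comm, hK, hV]
  ring

/-- A continuous function vanishing off the (bounded) box has finite mass. [folklore] -/
theorem lintegral_normSq_ne_top {L : ℝ} {G : Config N → ℂ} (hG : Continuous G)
    (hG0 : ∀ X, X ∉ boxN N L → G X = 0) : ∫⁻ X, (‖G X‖₊ : ℝ≥0∞) ^ 2 ≠ ⊤ := by
  rw [← setLIntegral_eq_of_support_subset (μ := volume) (s := boxN N L)]
  · exact (lintegral_boxN_normSq_lt_top hG L).ne
  · intro X hX
    by_contra h
    exact (Function.mem_support.1 hX) (by simp [hG0 X h])

/-- **Normalisation and the variational bound.** For a `C¹`, Dirichlet, symmetric `G` with mass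
`m = ∫|G|²`: a trial state `Θ` which, if `m ≠ 0`, is `G/√m` with energy `m⁻¹ Q(G)` (a junk `T₀`
otherwise), and `E₀(N, L) · m ≤ Q(G)` (trivial if `m = 0`). [cite: LSSY2005, (2.3)] -/
theorem exists_trialState_normalize {L : ℝ} (T₀ : TrialState N L) (v : ℝ → ℝ≥0∞)
    {G : Config N → ℂ} (hG : ContDiff ℝ 1 G) (hG0 : ∀ X, X ∉ boxN N L → G X = 0)
    (hGσ : ∀ (σ : Equiv.Perm (Fin N)) (X : Config N), G (X ∘ σ) = G X) :
    ∃ Θ : TrialState N L,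
      (∫⁻ X, (‖G X‖₊ : ℝ≥0∞) ^ 2 ≠ 0 →
        (Θ.ψ = fun X => ((Real.sqrt ((∫⁻ X, (‖G X‖₊ : ℝ≥0∞) ^ 2).toReal)⁻¹ : ℝ) : ℂ) * G X) ∧
          energy v Θ = (∫⁻ X, (‖G X‖₊ : ℝ≥0∞) ^ 2)⁻¹ *
            ∫⁻ X, kineticDensity G X + interaction v X * (‖G X‖₊ : ℝ≥0∞) ^ 2) ∧
      groundStateEnergy v N L * ∫⁻ X, (‖G X‖₊ : ℝ≥0∞) ^ 2 ≤
        ∫⁻ X, kineticDensity G X + interaction v X * (‖G X‖₊ : ℝ≥0∞) ^ 2 := by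
  set m : ℝ≥0∞ := ∫⁻ X, (‖G X‖₊ : ℝ≥0∞) ^ 2 with hm_def
  rcases eq_or_ne m 0 with hm | hm
  · exact ⟨T₀, fun h => absurd hm h, by rw [hm, mul_zero]; exact zero_le⟩
  have hmt : m ≠ ⊤ := lintegral_normSq_ne_top hG.continuous hG0
  set c : ℝ := Real.sqrt (m.toReal)⁻¹ with hc_def
  have hc2 : (‖(c : ℂ)‖₊ : ℝ≥0∞) ^ 2 = m⁻¹ := by
    rw [ExistsNonneg.coe_nnnorm_ofReal_sq, hc_def,
      Real.sq_sqrt (inv_nonneg.2 ENNReal.toReal_nonneg),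
      ENNReal.ofReal_inv_of_pos (ENNReal.toReal_pos hm hmt), ENNReal.ofReal_toReal hmt]
  have hsq : ∀ X, (‖(c : ℂ) * G X‖₊ : ℝ≥0∞) ^ 2 = m⁻¹ * (‖G X‖₊ : ℝ≥0∞) ^ 2 := fun X => by
    rw [nnnorm_mul, ENNReal.coe_mul, mul_pow, hc2]
  let Θ : TrialState N L := ⟨fun X => (c : ℂ) * G X, contDiff_const.mul hG,
    fun X hX => by simp [hG0 X hX], fun σ X => by rw [hGσ σ X], by
      simp_rw [hsq]
      rw [lintegral_const_mul' _ _ (ENNReal.inv_ne_top.2 hm), ENNReal.inv_mul_cancel hm hmt]⟩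
  have hE : energy v Θ =
      m⁻¹ * ∫⁻ X, kineticDensity G X + interaction v X * (‖G X‖₊ : ℝ≥0∞) ^ 2 := by
    show ∫⁻ X, kineticDensity (fun Y => (c : ℂ) * G Y) X +
        interaction v X * (‖(c : ℂ) * G X‖₊ : ℝ≥0∞) ^ 2 = _
    rw [rawEnergy_const_mul v (c : ℂ) (hG.differentiable one_ne_zero), hc2]
  refine ⟨Θ, fun _ => ⟨rfl, hE⟩, ?_⟩
  calc groundStateEnergy v N L * m ≤ energy v Θ * m :=
        mul_le_mul_left (groundStateEnergy_le_energy v Θ) _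
    _ = _ := by rw [hE, mul_comm m⁻¹, mul_assoc, ENNReal.inv_mul_cancel hm hmt, mul_one]

/-- **Key estimate** for trial states `S, T` and constants `a, b`:
`Q(aS + bT) + E₀ ∫|aS - bT|² ≤ 2|a|² ⟨S, H S⟩ + 2|b|² ⟨T, H T⟩` (parallelogram law, scaling, and
the variational bound for `aS - bT`). [cite: ReedSimonIV1978, §XIII.12 Thm XIII.46] -/
theorem rawEnergy_lincomb_le (v : ℝ → ℝ≥0∞) {L : ℝ} (S T : TrialState N L) (a b : ℂ) :
    (∫⁻ X, kineticDensity (fun Y => a * S.ψ Y + b * T.ψ Y) X +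
        interaction v X * (‖a * S.ψ X + b * T.ψ X‖₊ : ℝ≥0∞) ^ 2) +
      groundStateEnergy v N L * ∫⁻ X, (‖a * S.ψ X - b * T.ψ X‖₊ : ℝ≥0∞) ^ 2 ≤
      2 * ((‖a‖₊ : ℝ≥0∞) ^ 2 * energy v S) + 2 * ((‖b‖₊ : ℝ≥0∞) ^ 2 * energy v T) := by
  have hf : ContDiff ℝ 1 fun X => a * S.ψ X := contDiff_const.mul S.contDiff
  have hg : ContDiff ℝ 1 fun X => b * T.ψ X := contDiff_const.mul T.contDiff
  obtain ⟨_, -, hlow⟩ := exists_trialState_normalize S v (hf.sub hg)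
    (fun X hX => by simp [S.eq_zero X hX, T.eq_zero X hX])
    (fun σ X => by simp only [S.symm σ X, T.symm σ X])
  have hS := rawEnergy_const_mul v a (S.contDiff.differentiable one_ne_zero)
  have hT := rawEnergy_const_mul v b (T.contDiff.differentiable one_ne_zero)
  unfold energy
  rw [← hS, ← hT, ← rawEnergy_add_sub v hf hg]
  exact add_le_add_right hlow _

/-- The parallelogram law in `L²` for two trial states: `∫|aS + bT|² + ∫|aS - bT|² = 2|a|² + 2|b|²`.
[folklore] -/
theorem lintegral_lincomb_add_sub {L : ℝ} (S T : TrialState N L) (a b : ℂ) :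
    (∫⁻ X, (‖a * S.ψ X + b * T.ψ X‖₊ : ℝ≥0∞) ^ 2) +
        ∫⁻ X, (‖a * S.ψ X - b * T.ψ X‖₊ : ℝ≥0∞) ^ 2 =
      2 * (‖a‖₊ : ℝ≥0∞) ^ 2 + 2 * (‖b‖₊ : ℝ≥0∞) ^ 2 := by
  have hSm := S.contDiff.continuous.measurable
  have hTm := T.contDiff.continuous.measurable
  have hm1 : Measurable fun X => (‖a * S.ψ X + b * T.ψ X‖₊ : ℝ≥0∞) ^ 2 :=
    (((measurable_const.fun_mul hSm).fun_add
      (measurable_const.fun_mul hTm)).nnnorm.coe_nnreal_ennreal).pow_const 2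
  have hm2 : Measurable fun X => 2 * ((‖a‖₊ : ℝ≥0∞) ^ 2 * (‖S.ψ X‖₊ : ℝ≥0∞) ^ 2) :=
    ((hSm.nnnorm.coe_nnreal_ennreal.pow_const 2).const_mul _).const_mul _
  rw [← lintegral_add_left hm1]
  have hpt : ∀ X, (‖a * S.ψ X + b * T.ψ X‖₊ : ℝ≥0∞) ^ 2 + (‖a * S.ψ X - b * T.ψ X‖₊ : ℝ≥0∞) ^ 2 =
      2 * ((‖a‖₊ : ℝ≥0∞) ^ 2 * (‖S.ψ X‖₊ : ℝ≥0∞) ^ 2) +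
        2 * ((‖b‖₊ : ℝ≥0∞) ^ 2 * (‖T.ψ X‖₊ : ℝ≥0∞) ^ 2) := fun X => by
    rw [nnnorm_sq_add_sub, nnnorm_mul, nnnorm_mul, ENNReal.coe_mul, ENNReal.coe_mul, mul_pow,
      mul_pow]
  simp_rw [hpt]
  rw [lintegral_add_left hm2, lintegral_const_mul' _ _ (by finiteness),
    lintegral_const_mul' _ _ (by finiteness), lintegral_const_mul' _ _ (by finiteness),
    lintegral_const_mul' _ _ (by finiteness), S.norm_eq, T.norm_eq, mul_one, mul_one]

/-- **`L²` convergence of linear combinations**: if `∫|ψₙ - Ψ|² ≤ εₙ`, `∫|φₙ - Φ|² ≤ εₙ` with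
`εₙ → 0`, then `∫|(aψₙ + bφₙ) - (aΨ + bΦ)|² → 0`
(`|(aψ + bφ) - (aΨ + bΦ)|² ≤ 2|a|²|ψ - Ψ|² + 2|b|²|φ - Φ|²`). [folklore] -/
theorem tendsto_lincomb {ψ φ : ℕ → Config N → ℂ} {Ψ Φ : Config N → ℂ}
    (hψ : ∀ n, Measurable (ψ n)) (hΨ : Measurable Ψ) {tol : ℕ → ℝ≥0∞}
    (htol : Tendsto tol atTop (𝓝 0)) (h1 : ∀ n, ∫⁻ X, (‖ψ n X - Ψ X‖₊ : ℝ≥0∞) ^ 2 ≤ tol n)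
    (h2 : ∀ n, ∫⁻ X, (‖φ n X - Φ X‖₊ : ℝ≥0∞) ^ 2 ≤ tol n) (a b : ℂ) :
    Tendsto (fun n => ∫⁻ X, (‖(a * ψ n X + b * φ n X) - (a * Ψ X + b * Φ X)‖₊ : ℝ≥0∞) ^ 2)
      atTop (𝓝 0) := by
  have hlim : Tendsto (fun n => 2 * ((‖a‖₊ : ℝ≥0∞) ^ 2 * tol n) +
      2 * ((‖b‖₊ : ℝ≥0∞) ^ 2 * tol n)) atTop (𝓝 0) := by
    have ha := ENNReal.Tendsto.const_mul htol (Or.inr (by finiteness)) (a := (‖a‖₊ : ℝ≥0∞) ^ 2)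
    have hb := ENNReal.Tendsto.const_mul htol (Or.inr (by finiteness)) (a := (‖b‖₊ : ℝ≥0∞) ^ 2)
    rw [mul_zero] at ha hb
    have h := (ENNReal.Tendsto.const_mul ha (Or.inr ENNReal.ofNat_ne_top) (a := 2)).add
      (ENNReal.Tendsto.const_mul hb (Or.inr ENNReal.ofNat_ne_top) (a := 2))
    rwa [mul_zero, add_zero] at h
  refine tendsto_of_tendsto_of_tendsto_of_le_of_le tendsto_const_nhds hlim (fun _ => zero_le)
    fun n => ?_
  have hm : Measurable fun X => 2 * ((‖a‖₊ : ℝ≥0∞) ^ 2 * (‖ψ n X - Ψ X‖₊ : ℝ≥0∞) ^ 2) :=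
    ((((hψ n).fun_sub hΨ).nnnorm.coe_nnreal_ennreal.pow_const 2).const_mul _).const_mul _
  calc ∫⁻ X, (‖(a * ψ n X + b * φ n X) - (a * Ψ X + b * Φ X)‖₊ : ℝ≥0∞) ^ 2
      ≤ ∫⁻ X, 2 * ((‖a‖₊ : ℝ≥0∞) ^ 2 * (‖ψ n X - Ψ X‖₊ : ℝ≥0∞) ^ 2) +
          2 * ((‖b‖₊ : ℝ≥0∞) ^ 2 * (‖φ n X - Φ X‖₊ : ℝ≥0∞) ^ 2) := by
        refine lintegral_mono fun X => ?_
        have e : a * ψ n X + b * φ n X - (a * Ψ X + b * Φ X) =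
            a * (ψ n X - Ψ X) + b * (φ n X - Φ X) := by ring
        rw [e]
        refine (coe_nnnorm_add_sq_le _ _).trans_eq ?_
        rw [nnnorm_mul, nnnorm_mul, ENNReal.coe_mul, ENNReal.coe_mul, mul_pow, mul_pow]
    _ = 2 * ((‖a‖₊ : ℝ≥0∞) ^ 2 * ∫⁻ X, (‖ψ n X - Ψ X‖₊ : ℝ≥0∞) ^ 2) +
          2 * ((‖b‖₊ : ℝ≥0∞) ^ 2 * ∫⁻ X, (‖φ n X - Φ X‖₊ : ℝ≥0∞) ^ 2) := by
        rw [lintegral_add_left hm, lintegral_const_mul' _ _ (by finiteness),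
          lintegral_const_mul' _ _ (by finiteness), lintegral_const_mul' _ _ (by finiteness),
          lintegral_const_mul' _ _ (by finiteness)]
    _ ≤ _ := by gcongr <;> apply_rules [h1, h2]

end LincombGS

open LincombGS in
/-- **Stub `stub_lincombGroundState` of line `Sketch` — normalised linear combinations of ground
states are ground states (every `v`).** If `Ψ`, `Φ` are closed-form ground states
(`IsGroundState`) and `aΨ + bΦ` is normalised in `L²`, then `aΨ + bΦ` is a ground state:
near-minimising trial states `Sₙ → Ψ`, `Tₙ → Φ` (`exists_trialState_near`) give the symmetric `C¹`
Dirichlet functions `Gₙ = aSₙ + bTₙ`; by the parallelogram law and scaling of the raw quadratic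
form and the variational bound for `aSₙ - bTₙ`,
`Q(Gₙ) ≤ A(E₀ + 1/(n+1)) - E₀ ∫|aSₙ - bTₙ|²` with `A = 2|a|² + 2|b|² = ∫|Gₙ|² + ∫|aSₙ - bTₙ|²` and
`∫|Gₙ|² → 1`, so the normalised `Gₙ` form a near-minimising sequence converging to `aΨ + bΦ` in
`L²`, and `IsGroundState.of_tendstoL2` applies. [cite: ReedSimonIV1978, §XIII.12 Thm XIII.46] -/
theorem stub_lincombGroundState :
    ∀ (N : ℕ) (v : ℝ → ℝ≥0∞) (L : ℝ) (Ψ Φ : Config N → ℂ) (a b : ℂ),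
      IsGroundState v L Ψ → IsGroundState v L Φ →
      ∫⁻ X, (‖a * Ψ X + b * Φ X‖₊ : ℝ≥0∞) ^ 2 = 1 →
      IsGroundState v L (fun X => a * Ψ X + b * Φ X) := by
  intro N v L Ψ Φ a b hΨ hΦ h1
  have hE : groundStateEnergy v N L ≠ ⊤ := hΨ.groundStateEnergy_ne_top
  -- tolerances `1/(n+1)` and near-minimising approximants of `Ψ` and `Φ`
  set tol : ℕ → ℝ≥0∞ := fun n => ((n + 1 : ℕ) : ℝ≥0∞)⁻¹ with htol_def
  have htol_pos : ∀ n, 0 < tol n := fun n => ENNReal.inv_pos.2 (ENNReal.natCast_ne_top _)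
  have htol : Tendsto tol atTop (𝓝 0) :=
    ENNReal.tendsto_inv_nat_nhds_zero.comp (tendsto_add_atTop_nat 1)
  choose S hSE hSΨ using fun n => exists_trialState_near hΨ (htol_pos n) (htol_pos n)
  choose T hTE hTΦ using fun n => exists_trialState_near hΦ (htol_pos n) (htol_pos n)
  -- the combinations `Gₙ = a Sₙ + b Tₙ`: `C¹`, Dirichlet, symmetric; `Gₙ → aΨ + bΦ`, masses `→ 1`
  have hGc : ∀ n, ContDiff ℝ 1 fun X => a * (S n).ψ X + b * (T n).ψ X := fun n =>
    (contDiff_const.mul (S n).contDiff).add (contDiff_const.mul (T n).contDiff)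
  have hG0 : ∀ n X, X ∉ boxN N L → a * (S n).ψ X + b * (T n).ψ X = 0 := fun n X hX => by
    simp [(S n).eq_zero X hX, (T n).eq_zero X hX]
  have hGσ : ∀ n (σ : Equiv.Perm (Fin N)) (X : Config N),
      a * (S n).ψ (X ∘ σ) + b * (T n).ψ (X ∘ σ) = a * (S n).ψ X + b * (T n).ψ X :=
    fun n σ X => by rw [(S n).symm σ X, (T n).symm σ X]
  have hFm : Measurable fun X => a * Ψ X + b * Φ X :=
    (measurable_const.fun_mul hΨ.measurable).fun_add (measurable_const.fun_mul hΦ.measurable)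
  have hGF : Tendsto (fun n => ∫⁻ X, (‖(a * (S n).ψ X + b * (T n).ψ X) -
      (a * Ψ X + b * Φ X)‖₊ : ℝ≥0∞) ^ 2) atTop (𝓝 0) :=
    tendsto_lincomb (fun n => (S n).contDiff.continuous.measurable) hΨ.measurable htol hSΨ hTΦ a b
  have hm : Tendsto (fun n => ∫⁻ X, (‖a * (S n).ψ X + b * (T n).ψ X‖₊ : ℝ≥0∞) ^ 2) atTop (𝓝 1) :=
    ExistsNonneg.tendsto_lintegral_nnnorm_sq (G := fun n X => a * (S n).ψ X + b * (T n).ψ X)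
      (fun n => (hGc n).continuous.aestronglyMeasurable) hFm.aestronglyMeasurable h1 hGF
  -- `A = 2|a|² + 2|b|² = mₙ + dₙ`, so `dₙ → A - 1`
  set A : ℝ≥0∞ := 2 * (‖a‖₊ : ℝ≥0∞) ^ 2 + 2 * (‖b‖₊ : ℝ≥0∞) ^ 2 with hA_def
  have hAt : A ≠ ⊤ := by rw [hA_def]; finiteness
  have hsum : ∀ n, (∫⁻ X, (‖a * (S n).ψ X + b * (T n).ψ X‖₊ : ℝ≥0∞) ^ 2) +
      ∫⁻ X, (‖a * (S n).ψ X - b * (T n).ψ X‖₊ : ℝ≥0∞) ^ 2 = A :=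
    fun n => lintegral_lincomb_add_sub (S n) (T n) a b
  have hd : Tendsto (fun n => ∫⁻ X, (‖a * (S n).ψ X - b * (T n).ψ X‖₊ : ℝ≥0∞) ^ 2) atTop
      (𝓝 (A - 1)) := by
    refine (ENNReal.Tendsto.sub tendsto_const_nhds hm (Or.inl hAt) (a := A)).congr fun n => ?_
    have hmt : ∫⁻ X, (‖a * (S n).ψ X + b * (T n).ψ X‖₊ : ℝ≥0∞) ^ 2 ≠ ⊤ :=
      ne_top_of_le_ne_top hAt (le_self_add.trans (hsum n).le)
    exact (ENNReal.eq_sub_of_add_eq hmt ((add_comm _ _).trans (hsum n))).symm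
  -- the energy bound: `Q(Gₙ) ≤ A (E₀ + tolₙ) - E₀ dₙ → A E₀ - E₀ (A - 1) ≤ E₀`
  have hbound : ∀ n, (∫⁻ X, kineticDensity (fun Y => a * (S n).ψ Y + b * (T n).ψ Y) X +
      interaction v X * (‖a * (S n).ψ X + b * (T n).ψ X‖₊ : ℝ≥0∞) ^ 2) ≤
      A * (groundStateEnergy v N L + tol n) -
        groundStateEnergy v N L * ∫⁻ X, (‖a * (S n).ψ X - b * (T n).ψ X‖₊ : ℝ≥0∞) ^ 2 := by
    intro n
    have hdt : ∫⁻ X, (‖a * (S n).ψ X - b * (T n).ψ X‖₊ : ℝ≥0∞) ^ 2 ≠ ⊤ :=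
      ne_top_of_le_ne_top hAt (le_add_self.trans (hsum n).le)
    refine ENNReal.le_sub_of_add_le_right (ENNReal.mul_ne_top hE hdt)
      ((rawEnergy_lincomb_le v (S n) (T n) a b).trans ?_)
    rw [hA_def, add_mul, mul_assoc, mul_assoc]
    gcongr
    · exact hSE n
    · exact hTE n
  have hub : Tendsto (fun n => A * (groundStateEnergy v N L + tol n) -
      groundStateEnergy v N L * ∫⁻ X, (‖a * (S n).ψ X - b * (T n).ψ X‖₊ : ℝ≥0∞) ^ 2) atTop
      (𝓝 (A * groundStateEnergy v N L - groundStateEnergy v N L * (A - 1))) := by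
    have h1' : Tendsto (fun n => A * (groundStateEnergy v N L + tol n)) atTop
        (𝓝 (A * groundStateEnergy v N L)) := by
      have h := htol.const_add (groundStateEnergy v N L)
      rw [add_zero] at h
      exact ENNReal.Tendsto.const_mul h (Or.inr hAt)
    exact ENNReal.Tendsto.sub h1' (ENNReal.Tendsto.const_mul hd (Or.inr hE))
      (Or.inl (ENNReal.mul_ne_top hAt hE))
  have hval : A * groundStateEnergy v N L - groundStateEnergy v N L * (A - 1) ≤
      groundStateEnergy v N L := by
    rw [tsub_le_iff_right, mul_comm A, ← mul_one_add]
    exact mul_le_mul_right le_add_tsub _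
  -- the normalised trial states (junk where the mass vanishes, finitely often)
  choose Θ hΘ _hlow using fun n => exists_trialState_normalize (S n) v (hGc n) (hG0 n) (hGσ n)
  have hev : ∀ᶠ n in atTop, ∫⁻ X, (‖a * (S n).ψ X + b * (T n).ψ X‖₊ : ℝ≥0∞) ^ 2 ≠ 0 :=
    hm.eventually_ne one_ne_zero
  refine IsGroundState.of_tendstoL2 hFm (fun X hX => by simp [hΨ.eq_zero X hX, hΦ.eq_zero X hX])
    (fun σ X => by simp only [hΨ.symm σ X, hΦ.symm σ X]) hE (Φ := Θ) ?_ ?_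
  · -- `Θₙ → aΨ + bΦ` in `L²`: the normalising constants tend to `1`
    have hc : Tendsto (fun n => Real.sqrt ((∫⁻ X, (‖a * (S n).ψ X + b * (T n).ψ X‖₊ :
        ℝ≥0∞) ^ 2).toReal)⁻¹) atTop (𝓝 1) := by
      have h1' := (ENNReal.tendsto_toReal ENNReal.one_ne_top).comp hm
      rw [ENNReal.toReal_one] at h1'
      have h2' := (Real.continuous_sqrt.tendsto _).comp (h1'.inv₀ one_ne_zero)
      rwa [inv_one, Real.sqrt_one] at h2'
    refine (ExistsNonneg.tendsto_lintegral_const_mul_sub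
      (G := fun n X => a * (S n).ψ X + b * (T n).ψ X) hFm h1 hc hGF).congr'
      (hev.mono fun n hn => ?_)
    beta_reduce
    rw [(hΘ n hn).1]
  · -- `liminf energy Θₙ ≤ E₀`
    have hup : Tendsto (fun n => (∫⁻ X, (‖a * (S n).ψ X + b * (T n).ψ X‖₊ : ℝ≥0∞) ^ 2)⁻¹ *
        (A * (groundStateEnergy v N L + tol n) - groundStateEnergy v N L *
          ∫⁻ X, (‖a * (S n).ψ X - b * (T n).ψ X‖₊ : ℝ≥0∞) ^ 2)) atTop
        (𝓝 (A * groundStateEnergy v N L - groundStateEnergy v N L * (A - 1))) := by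
      have h := hm.inv
      rw [inv_one] at h
      have h' := ENNReal.Tendsto.mul h (Or.inl one_ne_zero) hub (Or.inr ENNReal.one_ne_top)
      rwa [one_mul] at h'
    refine ((liminf_le_liminf (hev.mono fun n hn => ?_)).trans hup.liminf_eq.le).trans hval
    rw [(hΘ n hn).2]
    exact mul_le_mul_right (hbound n) _

end Summit.AtomisticToContinuum.BoseEinsteinCondensation.Theorems.GroundStateRigidity

end
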